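import Literature.Geometry.Kaehler.LinearHomotopyOperator
import Literature.Geometry.Kaehler.PoincareLemmaStarConvex
import HarnessLib

/-!
# The homotopy operator of a linear homotopy, localised to fibre-star-shaped open sets

Continuation of `Literature/Geometry/Kaehler/LinearHomotopyOperator.lean` (the operator
`K = linHomOperator Q` of the linear homotopy `H_σ = id - (1 - σ) Q` and the homotopy formula
`d (K ω) + K (dω) = ω - P^*ω` for GLOBALLY smooth forms), after the pattern of
`PoincareLemmaStarConvex.lean` (localisation of the radial operator by cut-offs): here the
formula is localised to forms that are `C^∞` only on an open set `U` which is
**fibre-star-shaped** for `Q`, i.e. contains with every point `p` the whole segment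
`{H_σ p | σ ∈ [0, 1]}`:

* `linHomOperator_congr` — `K ω p` depends only on `ω` along the segment of `p`;
* `exists_contDiff_linHomOperator_eventuallyEq`, `contDiffOn_linHomOperator` — `K` preserves
  smoothness on `U`;
* `extDeriv_linHomOperator_add_of_mapsTo` — `d (K ω) p + K (dω) p = ω p - P^*ω p` for `p ∈ U`;
* `extDeriv_linHomOperator_of_closed_of_mapsTo` — **relative Poincaré lemma on `U`**: for `ω`
  closed on `U` with `P^*ω = 0` along `P(U)`, `d (K ω) = ω` on `U`.

For `E = E' × ℝ`, `Q (u, t) = (0, t)` and `U = V × ℝ` (or `V × (-δ, δ)`) this is the relative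
Poincaré lemma of a product neighbourhood of `V × {0}` used chart-wise in Moser arguments near a
hypersurface (McDuff–Salamon 2017, Lemma 3.2.1; Cannas da Silva–Guillemin–Woodward 2000, proof of
Thm. 1).

## References

* R. Bott, L. W. Tu, *Differential Forms in Algebraic Topology* (1982), §I.4. [BottTu1982Forms]
* D. McDuff, D. Salamon, *Introduction to Symplectic Topology*, 3rd ed. (2017), §3.2.
  [McDuffSalamon2017]
-/

noncomputable section

open scoped Topology ContDiff
open Set Filter MeasureTheory intervalIntegral ContinuousAlternatingMap

namespace Literature.Geometry.Kaehler

variable {E : Type*} [NormedAddCommGroup E] [NormedSpace ℝ E]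
  {F : Type*} [NormedAddCommGroup F] [NormedSpace ℝ F] {k : ℕ}

section Local

variable (Q : E →L[ℝ] E)

/-- `K ω p` depends only on the values of `ω` on the segment `{H_σ p | σ ∈ [0,1]}`. [folklore] -/
theorem linHomOperator_congr {β β' : E → E [⋀^Fin (k + 1)]→L[ℝ] F} {p : E}
    (h : ∀ σ ∈ Icc (0 : ℝ) 1, β (linHom Q σ p) = β' (linHom Q σ p)) :
    linHomOperator Q β p = linHomOperator Q β' p := by
  refine intervalIntegral.integral_congr fun σ hσ ↦ ?_
  rw [uIcc_of_le zero_le_one] at hσ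
  simp only [linHomIntegrand, h σ hσ]

/-- The segment `{H_σ p | σ ∈ [0,1]}` is compact. [folklore] -/
theorem isCompact_linHom_segment (p : E) :
    IsCompact ((fun σ : ℝ ↦ linHom Q σ p) '' Icc (0 : ℝ) 1) :=
  isCompact_Icc.image ((contDiff_linHom Q).continuous.clm_apply continuous_const)

/-- Segments of points near `p` stay inside any neighbourhood of the segment of `p`
(`H_σ q - H_σ p = H_σ (q - p)` and `‖H_σ‖ ≤ 1 + ‖Q‖` on `[0,1]`). [folklore] -/
theorem eventually_linHom_mem {p : E} {N : Set E} (hN : IsOpen N)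
    (hS : (fun σ : ℝ ↦ linHom Q σ p) '' Icc (0 : ℝ) 1 ⊆ N) :
    ∀ᶠ q in 𝓝 p, ∀ σ ∈ Icc (0 : ℝ) 1, linHom Q σ q ∈ N := by
  obtain ⟨δ, hδ, hδN⟩ := (isCompact_linHom_segment Q p).exists_thickening_subset_open hN hS
  have hC : 0 < 1 + ‖Q‖ := by positivity
  filter_upwards [Metric.ball_mem_nhds p (div_pos hδ hC)] with q hq σ hσ
  refine hδN (Metric.mem_thickening_iff.2 ⟨linHom Q σ p, ⟨σ, hσ, rfl⟩, ?_⟩)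
  rw [dist_eq_norm, ← map_sub]
  have hle : ‖linHom Q σ (q - p)‖ ≤ (1 + ‖Q‖) * ‖q - p‖ := by
    rw [linHom_apply]
    calc ‖q - p - (1 - σ) • Q (q - p)‖ ≤ ‖q - p‖ + ‖(1 - σ) • Q (q - p)‖ := norm_sub_le _ _
      _ ≤ ‖q - p‖ + 1 * (‖Q‖ * ‖q - p‖) := by
          rw [norm_smul]
          gcongr
          · rw [Real.norm_eq_abs, abs_of_nonneg (by linarith [hσ.2])]
            linarith [hσ.1]
          · exact Q.le_opNorm _
      _ = (1 + ‖Q‖) * ‖q - p‖ := by ring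
  calc ‖linHom Q σ (q - p)‖ ≤ (1 + ‖Q‖) * ‖q - p‖ := hle
    _ < (1 + ‖Q‖) * (δ / (1 + ‖Q‖)) := by
        gcongr
        rwa [← dist_eq_norm]
    _ = δ := mul_div_cancel₀ δ hC.ne'

variable [FiniteDimensional ℝ E] {U : Set E}

/-- **Localisation of the homotopy operator.** On an open set `U` containing the segments of its
points, for a form `β` that is `C^∞` on `U` and `p ∈ U`, there is a globally `C^∞` form `β'` (`β`
times a cut-off equal to `1` near the segment of `p`) agreeing with `β` near every point of the
segment and whose transform agrees with that of `β` near `p`. [folklore] -/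
theorem exists_contDiff_linHomOperator_eventuallyEq (hU : IsOpen U)
    (hst : ∀ p ∈ U, ∀ σ ∈ Icc (0 : ℝ) 1, linHom Q σ p ∈ U)
    {β : E → E [⋀^Fin (k + 1)]→L[ℝ] F} (hβ : ContDiffOn ℝ ∞ β U) {p : E} (hp : p ∈ U) :
    ∃ β' : E → E [⋀^Fin (k + 1)]→L[ℝ] F, ContDiff ℝ ∞ β' ∧
      (∀ σ ∈ Icc (0 : ℝ) 1, ∀ᶠ y in 𝓝 (linHom Q σ p), β' y = β y) ∧
      ∀ᶠ q in 𝓝 p, linHomOperator Q β' q = linHomOperator Q β q := by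
  have hS : (fun σ : ℝ ↦ linHom Q σ p) '' Icc (0 : ℝ) 1 ⊆ U := by
    rintro _ ⟨σ, hσ, rfl⟩
    exact hst p hp σ hσ
  obtain ⟨ψ, hψ, h1, h0⟩ :=
    exists_contDiff_one_nhdsSet_of_isCompact (isCompact_linHom_segment Q p) hU hS
  obtain ⟨N, hN, hSN, hNs⟩ := mem_nhdsSet_iff_exists.1 h1
  have hN1 : ∀ y ∈ N, ψ y = 1 := fun y hy ↦ hNs hy
  refine ⟨fun y ↦ ψ y • β y, contDiff_smul_of_eventuallyEq_zero hU hψ h0 hβ, ?_, ?_⟩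
  · intro σ hσ
    have hm : linHom Q σ p ∈ N := hSN ⟨σ, hσ, rfl⟩
    filter_upwards [hN.mem_nhds hm] with y hy
    rw [hN1 y hy, one_smul]
  · filter_upwards [eventually_linHom_mem Q hN hSN] with q hq
    exact linHomOperator_congr Q fun σ hσ ↦ by rw [hN1 _ (hq σ hσ), one_smul]

/-- **The homotopy operator preserves smoothness on fibre-star-shaped open sets.** [folklore] -/
theorem contDiffOn_linHomOperator (hU : IsOpen U)
    (hst : ∀ p ∈ U, ∀ σ ∈ Icc (0 : ℝ) 1, linHom Q σ p ∈ U)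
    {β : E → E [⋀^Fin (k + 1)]→L[ℝ] F} (hβ : ContDiffOn ℝ ∞ β U) :
    ContDiffOn ℝ ∞ (linHomOperator Q β) U := by
  intro p hp
  obtain ⟨β', hβ', -, hK⟩ := exists_contDiff_linHomOperator_eventuallyEq Q hU hst hβ hp
  exact ((contDiff_linHomOperator Q hβ').contDiffAt.congr_of_eventuallyEq
    (hK.mono fun q hq ↦ hq.symm)).contDiffWithinAt

/-- **The homotopy formula on a fibre-star-shaped open set**:
`d (K β) p + K (dβ) p = β p - P^*β p` at every `p ∈ U`, for `β` of positive degree `C^∞` on `U`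
(`F` complete). [cite: BottTu1982Forms, §I.4] -/
theorem extDeriv_linHomOperator_add_of_mapsTo [CompleteSpace F] (hU : IsOpen U)
    (hst : ∀ p ∈ U, ∀ σ ∈ Icc (0 : ℝ) 1, linHom Q σ p ∈ U)
    {β : E → E [⋀^Fin (k + 1)]→L[ℝ] F} (hβ : ContDiffOn ℝ ∞ β U) {p : E} (hp : p ∈ U) :
    extDeriv (linHomOperator Q β) p + linHomOperator Q (extDeriv β) p =
      β p - (β ((ContinuousLinearMap.id ℝ E - Q) p)).compContinuousLinearMap
        (ContinuousLinearMap.id ℝ E - Q) := by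
  obtain ⟨β', hβ', hseg, hK⟩ := exists_contDiff_linHomOperator_eventuallyEq Q hU hst hβ hp
  have h1 : extDeriv (linHomOperator Q β) p = extDeriv (linHomOperator Q β') p :=
    Filter.EventuallyEq.extDeriv_eq (hK.mono fun q hq ↦ hq.symm)
  have h2 : linHomOperator Q (extDeriv β) p = linHomOperator Q (extDeriv β') p :=
    linHomOperator_congr Q fun σ hσ ↦
      (Filter.EventuallyEq.extDeriv_eq (hseg σ hσ : β' =ᶠ[𝓝 _] β)).symm
  have h3 : β p = β' p := by
    have h := (hseg 1 (right_mem_Icc.2 zero_le_one)).self_of_nhds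
    rw [linHom_one] at h
    exact h.symm
  have h4 : β ((ContinuousLinearMap.id ℝ E - Q) p) = β' ((ContinuousLinearMap.id ℝ E - Q) p) := by
    have h := (hseg 0 (left_mem_Icc.2 zero_le_one)).self_of_nhds
    rw [linHom_zero] at h
    exact h.symm
  rw [h1, h2, h3, h4]
  exact extDeriv_linHomOperator_add Q hβ' p

/-- **Relative Poincaré lemma on a fibre-star-shaped open set**: if moreover `β` is closed on
`U` and `P^*β` vanishes at the end points `P p`, `p ∈ U`, then `d (K β) = β` on `U`.
[cite: McDuffSalamon2017, Lemma 3.2.1] -/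
theorem extDeriv_linHomOperator_of_closed_of_mapsTo [CompleteSpace F] (hU : IsOpen U)
    (hst : ∀ p ∈ U, ∀ σ ∈ Icc (0 : ℝ) 1, linHom Q σ p ∈ U)
    {β : E → E [⋀^Fin (k + 1)]→L[ℝ] F} (hβ : ContDiffOn ℝ ∞ β U)
    (hd : ∀ x ∈ U, extDeriv β x = 0)
    (h0 : ∀ x ∈ U, (β ((ContinuousLinearMap.id ℝ E - Q) x)).compContinuousLinearMap
      (ContinuousLinearMap.id ℝ E - Q) = 0)
    {p : E} (hp : p ∈ U) :
    extDeriv (linHomOperator Q β) p = β p := by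
  have h := extDeriv_linHomOperator_add_of_mapsTo Q hU hst hβ hp
  have hK : linHomOperator Q (extDeriv β) p =
      linHomOperator Q (0 : E → E [⋀^Fin (k + 1 + 1)]→L[ℝ] F) p :=
    linHomOperator_congr Q fun σ hσ ↦ by
      rw [Pi.zero_apply]
      exact hd _ (hst p hp σ hσ)
  rw [hK, linHomOperator_zero, Pi.zero_apply, add_zero, h0 p hp, sub_zero] at h
  exact h

end Local

end Literature.Geometry.Kaehler

end
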